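import Literature.NumberTheory.Sieve.FriableMoebiusRootSumStep
import Literature.NumberTheory.Sieve.FriableMoebiusRootSumBase
import HarnessLib

/-!
# Buchstab's law for the friable Möbius–root sum of a Bateman–Horn polynomial

Topic `Literature/NumberTheory/Sieve`. Everything here is PROVED; no definitions, no named facts.
Let `g ∈ ℤ[X]` form a one-polynomial Bateman–Horn system (`IsBatemanHornSystem ![g]`: irreducible,
positive leading coefficient, no fixed prime divisor), `ρ_g(d) = #{n mod d : g(n) ≡ 0}`
(`polyRootCountMod ![g] d`), `C(g)` its Bateman–Horn constant (`batemanHornConst ![g]`) and `ω`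
Buchstab's function (`buchstabOmega`). The **friable (truncated) Möbius–root sum**

`G_g(x, y) = ∑_{d ≤ x, P⁺(d) < y} μ(d) ρ_g(d)/d`   (`d ∈ Nat.smoothNumbersUpTo ⌊x⌋ ⌈y⌉`)

is the density of the main term of the level-`x` Type-I part of the Legendre–Eratosthenes sieve along
the values of `g` sifted by the primes `< y`. With `u = log x/log y`:

* `exists_abs_friableSum_sub_main_le` — **the law with its boundary layer**: for every `k ≥ 2` there
  is `C` with `|G_g(x, y) − C(g) ω(u)/log y − (R_g(x/y) − C(g))/log y| ≤ C/log² y` for all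
  `2 ≤ y ≤ x`, `log x ≤ k log y`, where `R_g(v) = ∑_{n ≤ v} μ(n)ρ_g(n)/n · log(v/n) → C(g)` is Landau's
  log-Riesz mean (the boundary layer at `u = 1`: `G_g(y, y) ≈ 0` while `C(g)/log y ≠ 0`);
* `exists_abs_friableSum_sub_buchstab_le` — for `1 < u₀ ≤ u ≤ U`: `|G_g(x, y) − C(g) ω(u)/log y| ≤ C/log² y`;
* `tendsto_log_mul_friableSum` — for fixed `u > 1`: `log y · G_g(y^u, y) → C(g) ω(u)`;
* `tendsto_log_mul_friableSum_nat` — the same along integers `B → ∞` with `x = B^s`, `s > 1`.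

So `λ_g(u) := lim log y · G_g(y^u, y)/C(g) = ω(u)` for `u > 1` (and `= 0` for `u < 1`): the truncated
Legendre density overshoots the Mertens product `∏_{p<y}(1 − ρ_g(p)/p) ~ e^{−γ} C(g)/log y` by the
factor `e^γ ω(u) → 1`. Proof: induction on `k` — base `u ≤ 2` (`FriableMoebiusRootSumBase`:
Landau's log-Riesz evaluation gives `G = C(g)/log x + (R(x/y) − C(g))/log y + O(1/log² y)`), step
`k → k + 1` by Buchstab's identity on `P⁺(d)` (`FriableMoebiusRootSumStep`) mirroring the tree's
rough-number law `RoughNumbersBuchstab`. The integer case `g = X` (`ρ ≡ 1`, `C = 1`) is the classical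
evaluation of the incomplete Möbius sum `∑_{d ≤ x, P⁺(d) < y} μ(d)/d = (ω(u) + o(1))/log y`
(de Bruijn 1950 / Tenenbaum III.6, dual to `Φ(x, y) ~ ω(u) x/log y`; cf. Alladi 1982 for
`∑_{d ≤ x, P⁺(d) ≤ y} μ(d)`).

## References

* G. Tenenbaum, *Introduction to analytic and probabilistic number theory*, 3rd ed., AMS 2015,
  Ch. III.6 (Buchstab's function and iteration). [Tenenbaum2015]
* N. G. de Bruijn, *On the number of uncancelled elements in the sieve of Eratosthenes*, Indag.
  Math. 12 (1950), 247–256. [deBruijn1950]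
* E. Landau, Math. Ann. 56 (1903), 645–670, Part II (the inputs `M_g`, `R_g`, `ϑ_g`). [LandauMathAnn1903]
-/

open Finset Real Polynomial Filter
open scoped Topology

noncomputable section

namespace Literature.NumberTheory.Sieve

namespace FriableMoebiusRoot

open Literature.NumberTheory.LFunctions

/-! ### The boundary-layer bound and the trivial range `y < e²` -/

/-- **Landau's log-Riesz rate in inverse-square-log form**: there is `C_B ≥ 0` with
`|R_g(v) − C(g)| ≤ C_B/(1 + log v)²` for all `v ≥ 1` (`C_R e^{−c√s} ≤ 4 C_R (1 + 24/c⁴)/(1 + s)²`).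
[cite: LandauMathAnn1903, Part II] -/
theorem exists_abs_logRiesz_sub_batemanHornConst_le_inv_sq {g : ℤ[X]} (hg : IsBatemanHornSystem ![g]) :
    ∃ CB : ℝ, 0 ≤ CB ∧ ∀ v : ℝ, 1 ≤ v →
      |(∑ n ∈ Icc 1 ⌊v⌋₊, (ArithmeticFunction.moebius n : ℝ) * (polyRootCountMod ![g] n : ℝ) / n *
          Real.log (v / n)) - batemanHornConst ![g]| ≤ CB / (1 + Real.log v) ^ 2 := by
  obtain ⟨c, hc, CR, hR⟩ := abs_logRieszMean_moebius_rootCount_sub_batemanHornConst_le hg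
  have hCR : 0 ≤ CR := by
    have h := (abs_nonneg _).trans (hR 1 le_rfl)
    rwa [Real.log_one, Real.sqrt_zero, mul_zero, Real.exp_zero, mul_one] at h
  refine ⟨4 * CR * (1 + 24 / c ^ 4), by positivity, fun v hv => ?_⟩
  refine (hR v hv).trans ?_
  set s := Real.log v with hs
  have hs0 : 0 ≤ s := Real.log_nonneg hv
  rw [le_div_iff₀ (by positivity)]
  have hexp1 : Real.exp (-c * Real.sqrt s) ≤ 1 := by
    rw [Real.exp_le_one_iff]; have := Real.sqrt_nonneg s; nlinarith
  rcases le_or_gt s 1 with hs1 | hs1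
  · -- `(1 + s)² ≤ 4`
    have h4 : (1 + s) ^ 2 ≤ 4 := by nlinarith
    calc CR * Real.exp (-c * Real.sqrt s) * (1 + s) ^ 2 ≤ CR * 1 * 4 :=
          mul_le_mul (mul_le_mul_of_nonneg_left hexp1 hCR) h4 (by positivity) (by positivity)
      _ ≤ 4 * CR * (1 + 24 / c ^ 4) := by
          have : 0 ≤ CR * (24 / c ^ 4) := by positivity
          nlinarith
  · -- `e^{−c√s} ≤ 24/(c⁴ s²)` and `(1 + s)² ≤ 4 s²`
    have hu : 0 ≤ c * Real.sqrt s := by positivity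
    have h := Real.pow_div_factorial_le_exp (c * Real.sqrt s) hu 4
    have h4 : (Nat.factorial 4 : ℝ) = 24 := by norm_num [Nat.factorial]
    rw [h4, mul_pow, show Real.sqrt s ^ 4 = s ^ 2 by
      rw [show (4:ℕ) = 2 * 2 from rfl, pow_mul, Real.sq_sqrt hs0]] at h
    rw [div_le_iff₀ (by norm_num : (0:ℝ) < 24)] at h
    have hpos : 0 < c ^ 4 * s ^ 2 := by positivity
    have hexp : Real.exp (-c * Real.sqrt s) * (c ^ 4 * s ^ 2) ≤ 24 := by
      rw [neg_mul, Real.exp_neg, inv_mul_le_iff₀ (Real.exp_pos _)]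
      linarith
    have hss : (1 + s) ^ 2 ≤ 4 * s ^ 2 := by nlinarith
    have hc4 : 0 < c ^ 4 := by positivity
    calc CR * Real.exp (-c * Real.sqrt s) * (1 + s) ^ 2 ≤ CR * Real.exp (-c * Real.sqrt s) * (4 * s ^ 2) :=
          mul_le_mul_of_nonneg_left hss (by positivity)
      _ = 4 * CR / c ^ 4 * (Real.exp (-c * Real.sqrt s) * (c ^ 4 * s ^ 2)) := by field_simp
      _ ≤ 4 * CR / c ^ 4 * 24 := mul_le_mul_of_nonneg_left hexp (by positivity)
      _ ≤ 4 * CR * (1 + 24 / c ^ 4) := by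
          rw [show 4 * CR / c ^ 4 * 24 = 4 * CR * (24 / c ^ 4) by ring]
          nlinarith

/-- **The trivial range `y < e²`**: for every `k` there is `T` with
`|G_g(x, y) − C(g) ω(u)/log y − (R_g(x/y) − C(g))/log y| ≤ T/log² y` whenever `2 ≤ y ≤ x`, `y < e²`,
`log x ≤ k log y` (everything is bounded: `|G| ≤ K(1 + 2k)`, `log y < 2`). [folklore] -/
theorem exists_abs_friableSum_sub_main_le_of_lt_exp_two {g : ℤ[X]} (hg : IsBatemanHornSystem ![g]) (k : ℕ) :
    ∃ T : ℝ, 0 ≤ T ∧ ∀ x y : ℝ, 2 ≤ y → y ≤ x → y < Real.exp 2 → Real.log x ≤ k * Real.log y →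
      |(∑ d ∈ Nat.smoothNumbersUpTo ⌊x⌋₊ ⌈y⌉₊,
          (ArithmeticFunction.moebius d : ℝ) * (polyRootCountMod ![g] d : ℝ) / d) -
        batemanHornConst ![g] * buchstabOmega (Real.log x / Real.log y) / Real.log y -
        ((∑ n ∈ Icc 1 ⌊x / y⌋₊, (ArithmeticFunction.moebius n : ℝ) * (polyRootCountMod ![g] n : ℝ) / n *
            Real.log (x / y / n)) - batemanHornConst ![g]) / Real.log y| ≤
        T / Real.log y ^ 2 := by
  have hirr : Irreducible g := bh_single_irreducible hg
  have hdeg : 0 < g.natDegree := by simpa using hg.natDegree_pos 0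
  obtain ⟨K, hK0, hK⟩ := DegreeOnePrimes.sum_moebius_sq_rootCount_div_le hirr hdeg
  obtain ⟨c, hc, CR, hR⟩ := abs_logRieszMean_moebius_rootCount_sub_batemanHornConst_le hg
  have hCR : 0 ≤ CR := by
    have h := (abs_nonneg _).trans (hR 1 le_rfl)
    rwa [Real.log_one, Real.sqrt_zero, mul_zero, Real.exp_zero, mul_one] at h
  set Cg := batemanHornConst ![g] with hCg
  set T₀ : ℝ := K * (1 + 2 * k) + 2 * |Cg| + 2 * CR with hT₀
  have hT00 : 0 ≤ T₀ := by simp only [hT₀]; positivity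
  refine ⟨4 * T₀, by positivity, fun x y hy2 hyx hye hxy => ?_⟩
  have hy0 : 0 < y := by linarith
  have hx0 : 0 < x := by linarith
  have hl2 : (1:ℝ) / 2 < Real.log 2 := by have := Real.log_two_gt_d9; linarith
  have hly : Real.log 2 ≤ Real.log y := Real.log_le_log two_pos hy2
  have hly0 : 0 < Real.log y := by linarith
  have hly2 : Real.log y < 2 := by rw [Real.log_lt_iff_lt_exp hy0]; exact hye
  have hlx : Real.log y ≤ Real.log x := Real.log_le_log hy0 hyx
  have hlx0 : 0 < Real.log x := by linarith
  have hk0 : (0 : ℝ) ≤ k := Nat.cast_nonneg k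
  -- `|G| ≤ K(1 + 2k)`
  have hX0 : 0 < ⌊x⌋₊ := Nat.floor_pos.mpr (by linarith)
  have hlogX : Real.log (⌊x⌋₊ : ℝ) ≤ 2 * k := by
    calc Real.log (⌊x⌋₊ : ℝ) ≤ Real.log x := Real.log_le_log (by exact_mod_cast hX0) (Nat.floor_le hx0.le)
      _ ≤ k * Real.log y := hxy
      _ ≤ k * 2 := mul_le_mul_of_nonneg_left hly2.le hk0
      _ = 2 * k := by ring
  have hG : |∑ d ∈ Nat.smoothNumbersUpTo ⌊x⌋₊ ⌈y⌉₊,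
      (ArithmeticFunction.moebius d : ℝ) * (polyRootCountMod ![g] d : ℝ) / d| ≤ K * (1 + 2 * k) := by
    refine (Finset.abs_sum_le_sum_abs _ _).trans ?_
    calc ∑ d ∈ Nat.smoothNumbersUpTo ⌊x⌋₊ ⌈y⌉₊, |(ArithmeticFunction.moebius d : ℝ) * (polyRootCountMod ![g] d : ℝ) / d|
        ≤ ∑ d ∈ Icc 1 ⌊x⌋₊, |(ArithmeticFunction.moebius d : ℝ) * (polyRootCountMod ![g] d : ℝ) / d| :=
          Finset.sum_le_sum_of_subset_of_nonneg (smoothNumbersUpTo_subset_Icc ⌊x⌋₊ ⌈y⌉₊)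
            fun _ _ _ => abs_nonneg _
      _ = ∑ d ∈ Icc 1 ⌊x⌋₊, (ArithmeticFunction.moebius d : ℝ) ^ 2 * (polyRootCountMod ![g] d : ℝ) / d := by
          refine Finset.sum_congr rfl fun d _ => ?_
          rw [abs_div, abs_mul, abs_moebius_eq_sq, Nat.abs_cast, Nat.abs_cast]
      _ ≤ K * (1 + Real.log (⌊x⌋₊ : ℝ)) := hK ⌊x⌋₊
      _ ≤ K * (1 + 2 * k) := mul_le_mul_of_nonneg_left (by linarith) hK0
  -- `|C ω(u)/log y| ≤ 2|C|`, `|(R − C)/log y| ≤ 2 C_R`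
  have hC : |Cg * buchstabOmega (Real.log x / Real.log y) / Real.log y| ≤ 2 * |Cg| := by
    rw [abs_div, abs_mul, abs_of_pos hly0, div_le_iff₀ hly0]
    have h1 : |buchstabOmega (Real.log x / Real.log y)| ≤ 1 := abs_buchstabOmega_le_one _
    have h2 := mul_le_mul_of_nonneg_left h1 (abs_nonneg Cg)
    have h3 := mul_le_mul_of_nonneg_left (show (1:ℝ) ≤ 2 * Real.log y by linarith) (abs_nonneg Cg)
    linarith
  have hBL : |((∑ n ∈ Icc 1 ⌊x / y⌋₊, (ArithmeticFunction.moebius n : ℝ) * (polyRootCountMod ![g] n : ℝ) / n *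
      Real.log (x / y / n)) - Cg) / Real.log y| ≤ 2 * CR := by
    have hV : 1 ≤ x / y := by rw [le_div_iff₀ hy0]; linarith
    have h := hR (x / y) hV
    have he : CR * Real.exp (-c * Real.sqrt (Real.log (x / y))) ≤ CR := by
      calc CR * Real.exp (-c * Real.sqrt (Real.log (x / y))) ≤ CR * 1 := by
            refine mul_le_mul_of_nonneg_left ?_ hCR
            rw [Real.exp_le_one_iff]
            have := Real.sqrt_nonneg (Real.log (x / y))
            nlinarith
        _ = CR := mul_one _
    rw [abs_div, abs_of_pos hly0, div_le_iff₀ hly0]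
    nlinarith [h.trans he]
  have htot : |(∑ d ∈ Nat.smoothNumbersUpTo ⌊x⌋₊ ⌈y⌉₊,
        (ArithmeticFunction.moebius d : ℝ) * (polyRootCountMod ![g] d : ℝ) / d) -
      Cg * buchstabOmega (Real.log x / Real.log y) / Real.log y -
      ((∑ n ∈ Icc 1 ⌊x / y⌋₊, (ArithmeticFunction.moebius n : ℝ) * (polyRootCountMod ![g] n : ℝ) / n *
        Real.log (x / y / n)) - Cg) / Real.log y| ≤ T₀ := by
    refine (abs_sub _ _).trans ((add_le_add ((abs_sub _ _).trans (add_le_add hG hC)) hBL).trans ?_)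
    simp only [hT₀]; linarith
  refine htot.trans ?_
  rw [le_div_iff₀ (by positivity)]
  have h4 : Real.log y ^ 2 ≤ 4 := by nlinarith
  nlinarith [mul_le_mul_of_nonneg_left h4 hT00]

/-! ### The induction -/

/-- **Buchstab's law for the friable Möbius–root sum, with its boundary layer**: for a
one-polynomial Bateman–Horn system `g` and every `k ≥ 2` there is `C` such that for all
`2 ≤ y ≤ x` with `log x ≤ k log y` (`u = log x/log y`),
`|∑_{d ≤ x, P⁺(d) < y} μ(d)ρ_g(d)/d − C(g) ω(u)/log y − (R_g(x/y) − C(g))/log y| ≤ C/log² y`,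
`R_g(v) = ∑_{n ≤ v} μ(n)ρ_g(n)/n · log(v/n)` (Landau's log-Riesz mean, `→ C(g)`).
Induction on `k`: `exists_abs_friableSum_sub_main_le_base`, `abs_friableSum_sub_main_step`.
[cite: Tenenbaum2015, Ch. III.6] -/
theorem exists_abs_friableSum_sub_main_le {g : ℤ[X]} (hg : IsBatemanHornSystem ![g]) (k : ℕ) (hk : 2 ≤ k) :
    ∃ C : ℝ, 0 ≤ C ∧ ∀ x y : ℝ, 2 ≤ y → y ≤ x → Real.log x ≤ k * Real.log y →
      |(∑ d ∈ Nat.smoothNumbersUpTo ⌊x⌋₊ ⌈y⌉₊,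
          (ArithmeticFunction.moebius d : ℝ) * (polyRootCountMod ![g] d : ℝ) / d) -
        batemanHornConst ![g] * buchstabOmega (Real.log x / Real.log y) / Real.log y -
        ((∑ n ∈ Icc 1 ⌊x / y⌋₊, (ArithmeticFunction.moebius n : ℝ) * (polyRootCountMod ![g] n : ℝ) / n *
            Real.log (x / y / n)) - batemanHornConst ![g]) / Real.log y| ≤
        C / Real.log y ^ 2 := by
  have hirr : Irreducible g := bh_single_irreducible hg
  have hdeg : 0 < g.natDegree := by simpa using hg.natDegree_pos 0
  obtain ⟨b₀, CE, hM⟩ := DegreeOnePrimes.abs_sum_primesLE_rootCount_div_sub_loglog_le hirr hdeg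
  obtain ⟨CB, hCB, hBL⟩ := exists_abs_logRiesz_sub_batemanHornConst_le_inv_sq hg
  have hCE : 0 ≤ CE := mertensConst_nonneg hM
  induction k, hk using Nat.le_induction with
  | base =>
    obtain ⟨C, hC0, h⟩ := exists_abs_friableSum_sub_main_le_base hg
    exact ⟨C, hC0, fun x y hy hyx hxy => h x y hy hyx (by exact_mod_cast hxy)⟩
  | succ k hk ih =>
    obtain ⟨C, hC, hPk⟩ := ih
    obtain ⟨T, hT0, hT⟩ := exists_abs_friableSum_sub_main_le_of_lt_exp_two hg (k + 1)
    set CS : ℝ := C + 2 * CB + 4 * ((C + CB) * (1 / 2 + 3 * CE) +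
      |batemanHornConst ![g]| * ((2 + (k + 3) ^ 3) * CE + 12 + 4 * k)) with hCS
    have hCS0 : 0 ≤ CS := by simp only [hCS]; positivity
    refine ⟨C + CS + T, by positivity, fun x y hy hyx hxy => ?_⟩
    push_cast at hxy
    have hly : 0 < Real.log y := Real.log_pos (by linarith)
    have hconv : ∀ {D : ℝ}, D ≤ C + CS + T → ∀ {A : ℝ}, A ≤ D / Real.log y ^ 2 →
        A ≤ (C + CS + T) / Real.log y ^ 2 := fun hD _ hA =>
      hA.trans (div_le_div_of_nonneg_right hD (by positivity))
    by_cases h1 : Real.log x ≤ k * Real.log y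
    · exact hconv (by linarith) (hPk x y hy hyx h1)
    push Not at h1
    rcases lt_or_ge y (Real.exp 2) with h2 | h2
    · exact hconv (by linarith) (hT x y hy hyx h2 (by push_cast; exact hxy))
    · exact hconv (by linarith) (abs_friableSum_sub_main_step hC hCB hM hk hPk hBL h2 hyx h1 hxy)

/-! ### Corollaries: compact ranges of `u` and the limit forms -/

/-- **Buchstab's law for the friable Möbius–root sum away from the boundary layer**: for
`1 < u₀` and any `U` there is `C` with `|∑_{d ≤ x, P⁺(d) < y} μ(d)ρ_g(d)/d − C(g) ω(u)/log y| ≤ C/log² y`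
for all `2 ≤ y ≤ x` with `u₀ log y ≤ log x ≤ U log y` (`u = log x/log y`; the boundary-layer term is
`≤ C_B/((u₀ − 1)² log³ y)` there). [cite: Tenenbaum2015, Ch. III.6] -/
theorem exists_abs_friableSum_sub_buchstab_le {g : ℤ[X]} (hg : IsBatemanHornSystem ![g]) {u₀ : ℝ}
    (hu₀ : 1 < u₀) (U : ℝ) :
    ∃ C : ℝ, 0 ≤ C ∧ ∀ x y : ℝ, 2 ≤ y → y ≤ x → u₀ * Real.log y ≤ Real.log x → Real.log x ≤ U * Real.log y →
      |(∑ d ∈ Nat.smoothNumbersUpTo ⌊x⌋₊ ⌈y⌉₊,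
          (ArithmeticFunction.moebius d : ℝ) * (polyRootCountMod ![g] d : ℝ) / d) -
        batemanHornConst ![g] * buchstabOmega (Real.log x / Real.log y) / Real.log y| ≤
        C / Real.log y ^ 2 := by
  obtain ⟨C, hC0, hP⟩ := exists_abs_friableSum_sub_main_le hg (max 2 ⌈U⌉₊) (le_max_left _ _)
  obtain ⟨CB, hCB, hBL⟩ := exists_abs_logRiesz_sub_batemanHornConst_le_inv_sq hg
  refine ⟨C + 2 * CB / (u₀ - 1) ^ 2, by positivity, fun x y hy hyx hlo hhi => ?_⟩
  have hy0 : 0 < y := by linarith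
  have hx0 : 0 < x := by linarith
  have hl2 : (1:ℝ) / 2 < Real.log 2 := by have := Real.log_two_gt_d9; linarith
  have hly2 : Real.log 2 ≤ Real.log y := Real.log_le_log two_pos hy
  have hly : 0 < Real.log y := by linarith
  have hk : Real.log x ≤ ((max 2 ⌈U⌉₊ : ℕ) : ℝ) * Real.log y := by
    refine hhi.trans (mul_le_mul_of_nonneg_right ?_ hly.le)
    calc U ≤ ⌈U⌉₊ := Nat.le_ceil U
      _ ≤ ((max 2 ⌈U⌉₊ : ℕ) : ℝ) := by exact_mod_cast le_max_right _ _
  have h1 := hP x y hy hyx hk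
  have hv : 1 ≤ x / y := by rw [le_div_iff₀ hy0]; linarith
  have h2 := hBL (x / y) hv
  have hlv : (u₀ - 1) * Real.log y ≤ Real.log (x / y) := by
    rw [Real.log_div hx0.ne' hy0.ne']; linarith
  have hBLb : |((∑ n ∈ Icc 1 ⌊x / y⌋₊, (ArithmeticFunction.moebius n : ℝ) * (polyRootCountMod ![g] n : ℝ) / n *
      Real.log (x / y / n)) - batemanHornConst ![g]) / Real.log y| ≤ 2 * CB / (u₀ - 1) ^ 2 / Real.log y ^ 2 := by
    rw [abs_div, abs_of_pos hly, div_le_iff₀ hly]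
    refine h2.trans ?_
    have hd : 0 < (u₀ - 1) * Real.log y := mul_pos (by linarith) hly
    calc CB / (1 + Real.log (x / y)) ^ 2 ≤ CB / ((u₀ - 1) * Real.log y) ^ 2 :=
          div_le_div_of_nonneg_left hCB (by positivity) (pow_le_pow_left₀ hd.le (by linarith) 2)
      _ = CB / (u₀ - 1) ^ 2 / Real.log y ^ 2 := by rw [mul_pow, div_div]
      _ ≤ CB / (u₀ - 1) ^ 2 / Real.log y ^ 2 * (2 * Real.log y) :=
          le_mul_of_one_le_right (by positivity) (by linarith)
      _ = 2 * CB / (u₀ - 1) ^ 2 / Real.log y ^ 2 * Real.log y := by ring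
  have hsplit : (C + 2 * CB / (u₀ - 1) ^ 2) / Real.log y ^ 2 =
      C / Real.log y ^ 2 + 2 * CB / (u₀ - 1) ^ 2 / Real.log y ^ 2 := by ring
  rw [hsplit]
  rw [abs_le] at h1 hBLb ⊢
  constructor <;> linarith [h1.1, h1.2, hBLb.1, hBLb.2]

/-- **The limit form**: for a one-polynomial Bateman–Horn system `g` and fixed `u > 1`,
`log y · ∑_{d ≤ y^u, P⁺(d) < y} μ(d)ρ_g(d)/d → C(g) ω(u)` as `y → ∞` (`ω` = Buchstab's function).
[cite: Tenenbaum2015, Ch. III.6] -/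
theorem tendsto_log_mul_friableSum {g : ℤ[X]} (hg : IsBatemanHornSystem ![g]) {u : ℝ} (hu : 1 < u) :
    Tendsto (fun y : ℝ => Real.log y * ∑ d ∈ Nat.smoothNumbersUpTo ⌊y ^ u⌋₊ ⌈y⌉₊,
        (ArithmeticFunction.moebius d : ℝ) * (polyRootCountMod ![g] d : ℝ) / d) atTop
      (𝓝 (batemanHornConst ![g] * buchstabOmega u)) := by
  obtain ⟨C, hC0, h⟩ := exists_abs_friableSum_sub_buchstab_le hg hu u
  have hbound : ∀ᶠ y : ℝ in atTop, |Real.log y * ∑ d ∈ Nat.smoothNumbersUpTo ⌊y ^ u⌋₊ ⌈y⌉₊,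
      (ArithmeticFunction.moebius d : ℝ) * (polyRootCountMod ![g] d : ℝ) / d -
      batemanHornConst ![g] * buchstabOmega u| ≤ C / Real.log y := by
    filter_upwards [eventually_ge_atTop (2 : ℝ)] with y hy
    have hy0 : 0 < y := by linarith
    have hy1 : 1 ≤ y := by linarith
    have hly : 0 < Real.log y := Real.log_pos (by linarith)
    have hlog : Real.log (y ^ u) = u * Real.log y := Real.log_rpow hy0 u
    have hyx : y ≤ y ^ u := by
      calc y = y ^ (1:ℝ) := (Real.rpow_one y).symm
        _ ≤ y ^ u := Real.rpow_le_rpow_of_exponent_le hy1 hu.le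
    have hb := h (y ^ u) y hy hyx (by rw [hlog]) (by rw [hlog])
    have hu' : Real.log (y ^ u) / Real.log y = u := by
      rw [hlog, mul_div_assoc, div_self hly.ne', mul_one]
    rw [hu'] at hb
    have heq : Real.log y * ∑ d ∈ Nat.smoothNumbersUpTo ⌊y ^ u⌋₊ ⌈y⌉₊,
        (ArithmeticFunction.moebius d : ℝ) * (polyRootCountMod ![g] d : ℝ) / d -
        batemanHornConst ![g] * buchstabOmega u =
        Real.log y * ((∑ d ∈ Nat.smoothNumbersUpTo ⌊y ^ u⌋₊ ⌈y⌉₊,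
          (ArithmeticFunction.moebius d : ℝ) * (polyRootCountMod ![g] d : ℝ) / d) -
          batemanHornConst ![g] * buchstabOmega u / Real.log y) := by
      field_simp
    rw [heq, abs_mul, abs_of_pos hly]
    calc Real.log y * |(∑ d ∈ Nat.smoothNumbersUpTo ⌊y ^ u⌋₊ ⌈y⌉₊,
          (ArithmeticFunction.moebius d : ℝ) * (polyRootCountMod ![g] d : ℝ) / d) -
          batemanHornConst ![g] * buchstabOmega u / Real.log y| ≤ Real.log y * (C / Real.log y ^ 2) :=
          mul_le_mul_of_nonneg_left hb hly.le
      _ = C / Real.log y := by field_simp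
  have hzero : Tendsto (fun y : ℝ => C / Real.log y) atTop (𝓝 0) :=
    tendsto_const_nhds.div_atTop Real.tendsto_log_atTop
  rw [tendsto_iff_norm_sub_tendsto_zero]
  refine squeeze_zero' (Eventually.of_forall fun y => norm_nonneg _) ?_ hzero
  filter_upwards [hbound] with y hy
  rw [Real.norm_eq_abs]
  exact hy

/-- **The limit form along integers** (the shape consumed by Type-I main terms of Bateman–Horn
sieves: level `D = B^s`, sifting primes `p < B`): for `s > 1`,
`log B · ∑_{d ≤ B^s, P⁺(d) < B} μ(d)ρ_g(d)/d → C(g) ω(s)` as `B → ∞`. [cite: Tenenbaum2015, Ch. III.6] -/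
theorem tendsto_log_mul_friableSum_nat {g : ℤ[X]} (hg : IsBatemanHornSystem ![g]) {s : ℝ} (hs : 1 < s) :
    Tendsto (fun B : ℕ => Real.log B * ∑ d ∈ Nat.smoothNumbersUpTo ⌊(B : ℝ) ^ s⌋₊ B,
        (ArithmeticFunction.moebius d : ℝ) * (polyRootCountMod ![g] d : ℝ) / d) atTop
      (𝓝 (batemanHornConst ![g] * buchstabOmega s)) := by
  have h := (tendsto_log_mul_friableSum hg hs).comp tendsto_natCast_atTop_atTop
  refine h.congr fun B => ?_
  simp only [Function.comp_apply, Nat.ceil_natCast]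

end FriableMoebiusRoot

end Literature.NumberTheory.Sieve
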